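import Summits.KontsevichZagierPeriods.KontsevichZagierPeriods.Theorems.SymplecticScissorsRealOnePeriodRelationsStubSaHomotopicAux2

/-!
# Stub `stub_saHomotopic` of crux `SymplecticScissors.RealOnePeriodRelations`
# (stmt-KontsevichZagierPeriods-10042, line `nash-retraction-thin-strip`) — the homotopy

From `D : SaData Z γ`:
* `SaData.repar` — the change of parameter `f` with `K_A(0, ·) = γ ∘ f`;
* `SaData.homA` — the link-insertion homotopy `K_A` from `γ ∘ f` to the path
  `Π_r (λ_r⁻¹ ⋆ γ_r ⋆ λ_{r+1})` through the break points (junction `r` moves along `λ_r`);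
* `SaData.homB` — the piecewise chart-straight homotopy `K_B` from `K_A(1, ·)` to `γ'` (on the
  `r`-th piece both paths lie in the chart region `Ω_r`, whose coordinate image is a convex disc,
  and share the end points `b_r`, `b_{r+1}`);
* `SaData.assemble` — `γ'` as a `CurvePath`, the paths in the subspace `Z(ℂ)` and
  `γ ≃ γ ∘ f ≃ K_A(1, ·) ≃ γ'` with fixed end points (`Path.Homotopy.reparam` and two explicit
  `Path.Homotopy`s), in the format of the stub.

References: A. Huber, G. Wüstholz, *Transcendence and Linear Relations of 1-Periods* (CUP 2022),
§3.3.1.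
-/

noncomputable section

open scoped BigOperators Topology unitInterval
open Set Filter Metric MvPolynomial
open Literature.NumberTheory.Transcendental Literature.NumberTheory.Transcendental.CurvePeriods
open Literature.ModelTheory.ExponentialFields (IsSemialgebraic)

namespace Summit.KontsevichZagierPeriods.SymplecticScissors.RealOnePeriodRelations.SaHomotopic

variable {Z : CurveData}

namespace SaData

variable {γ : CurvePath Z} (D : SaData Z γ)

/-! ### The reparametrisation of `γ` -/

/-- The change of parameter `f(t) = Σ_r clamp01(3(N t − r) − 1)/N`: on the `k`-th piece
`f(t) = k/N + clamp01(3(N t − k) − 1)/N` (pause, triple speed, pause). [folklore] -/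
def repar (t : ℝ) : ℝ := ∑ r ∈ Finset.range D.N, clamp01 (3 * ((D.N : ℝ) * t - r) - 1) / D.N

/-- Evaluation of `f` on the `k`-th piece. [folklore] -/
theorem repar_eval {k : ℕ} (hk : k < D.N) {t : ℝ}
    (ht : t ∈ Icc ((k : ℝ) / D.N) (((k : ℝ) + 1) / D.N)) :
    D.repar t = (k : ℝ) / D.N + clamp01 (3 * ((D.N : ℝ) * t - k) - 1) / D.N := by
  have h := telescope_eval (fun r : ℕ => (r : ℝ) / D.N)
    (fun r : ℕ => (r : ℝ) / D.N + clamp01 (3 * ((D.N : ℝ) * t - r) - 1) / D.N) hk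
    (fun r hr => ?_) (fun r hkr _ => ?_)
  · simp only [Nat.cast_zero, zero_div, zero_add, add_sub_cancel_left] at h
    exact h
  · show (r : ℝ) / D.N + clamp01 (3 * ((D.N : ℝ) * t - r) - 1) / D.N = ((r + 1 : ℕ) : ℝ) / D.N
    have h1 := one_le_local D.hN (succ_div_le_of_lt hr ht.1) (r := r)
    rw [clamp01_of_one_le (by linarith), div_add_one_div, cast_succ_div]
  · show (r : ℝ) / D.N + clamp01 (3 * ((D.N : ℝ) * t - r) - 1) / D.N = (r : ℝ) / D.N
    have h0 := local_nonpos D.hN (le_div_of_lt hkr ht.2) (r := r)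
    rw [clamp01_of_nonpos (by linarith), zero_div, add_zero]

/-- `f` maps the `k`-th piece into itself. [folklore] -/
theorem repar_mem_piece {k : ℕ} (hk : k < D.N) {t : ℝ}
    (ht : t ∈ Icc ((k : ℝ) / D.N) (((k : ℝ) + 1) / D.N)) :
    D.repar t ∈ Icc ((k : ℝ) / D.N) (((k : ℝ) + 1) / D.N) := by
  rw [D.repar_eval hk ht]
  exact div_add_clamp01_div_mem D.hN _

/-- `f([0,1]) ⊆ [0,1]`. [folklore] -/
theorem repar_mem {t : ℝ} (ht : t ∈ Icc (0 : ℝ) 1) : D.repar t ∈ Icc (0 : ℝ) 1 := by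
  obtain ⟨k, hk, hk1, hk2⟩ := exists_piece_index D.hN ht
  exact piece_subset D.hN hk (D.repar_mem_piece hk ⟨hk1, hk2⟩)

/-- `f(0) = 0`. [folklore] -/
theorem repar_zero : D.repar 0 = 0 := by
  rw [D.repar_eval D.hN zero_mem_firstPiece]
  norm_num [clamp01_of_nonpos]

/-- `f(1) = 1`. [folklore] -/
theorem repar_one : D.repar 1 = 1 := by
  have hk : D.N - 1 < D.N := Nat.sub_lt D.hN one_pos
  have hN' : (0 : ℝ) < D.N := by exact_mod_cast D.hN
  rw [D.repar_eval hk (one_mem_lastPiece D.hN)]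
  have h1 : 1 ≤ (D.N : ℝ) * 1 - ((D.N - 1 : ℕ) : ℝ) :=
    one_le_local D.hN (le_of_eq (pred_add_one_div D.hN))
  rw [clamp01_of_one_le (by linarith), div_add_one_div, pred_add_one_div D.hN]

/-- `f` is continuous. [folklore] -/
theorem continuous_repar : Continuous D.repar :=
  continuous_finsetSum _ fun _ _ => (continuous_clamp01.comp ((continuous_const.mul
    ((continuous_const.mul continuous_id).sub continuous_const)).sub continuous_const)).div_const _

/-! ### The link-insertion homotopy -/

/-- **The link-insertion homotopy** `K_A(s,t) = λ₀(s) + Σ_r (pieceA_r(s,t) − λ_r(s))`: on the `k`-th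
piece it is `pieceA_k`. [folklore] -/
def homA (q : ℝ × ℝ) : Fin Z.n → ℂ :=
  D.lam 0 q.1 + ∑ r ∈ Finset.range D.N, (pieceA (pext γ) D.lam D.N r q - D.lam r q.1)

/-- Evaluation of `K_A` on the `k`-th piece. [folklore] -/
theorem homA_eval {k : ℕ} (hk : k < D.N) (s : ℝ) {t : ℝ}
    (ht : t ∈ Icc ((k : ℝ) / D.N) (((k : ℝ) + 1) / D.N)) :
    D.homA (s, t) = pieceA (pext γ) D.lam D.N k (s, t) := by
  unfold homA
  exact telescope_eval (fun r => D.lam r s) (fun r => pieceA (pext γ) D.lam D.N r (s, t)) hk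
    (fun r hr => pieceA_of_ge D.hN (D.hlam0 r (hr.trans hk).le) (succ_div_le_of_lt hr ht.1))
    (fun r hkr hrN => pieceA_of_le D.hN (D.hlam0' hrN) (le_div_of_lt hkr ht.2))

/-- `K_A` is continuous on `ℝ²`. [folklore] -/
theorem continuous_homA : Continuous D.homA := by
  unfold homA
  refine ((D.hlamc 0 (Nat.zero_le _)).comp continuous_fst).add
    (continuous_finsetSum _ fun r hr => ?_)
  have hrN : r < D.N := Finset.mem_range.mp hr
  exact (continuous_pieceA (continuous_pext γ) (D.hlamc r hrN.le)
    (D.hlamc (r + 1) (Nat.succ_le_of_lt hrN))).sub ((D.hlamc r hrN.le).comp continuous_fst)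

/-- The `k`-th piece of `K_A` lies in `Ω_k ∩ Z(ℂ)`. [folklore] -/
theorem pieceA_memΩ {k : ℕ} (hk : k < D.N) (s t : ℝ) :
    pieceA (pext γ) D.lam D.N k (s, t) ∈ D.Ω k ∩ Z.points :=
  pieceA_mem (S := D.Ω k ∩ Z.points) D.hN (D.hlam0 k hk.le) (D.hlam0' hk)
    (fun v => D.hlamΩ k hk v) (fun v => D.hlamΩ' k hk v)
    (fun u hu => ⟨D.hPΩ k hk u hu, pext_mem γ u⟩) s t

/-- `K_A([0,1]²) ⊆ Z(ℂ)` (indeed for all `s`). [folklore] -/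
theorem homA_mem (s : ℝ) {t : ℝ} (ht : t ∈ Icc (0 : ℝ) 1) : D.homA (s, t) ∈ Z.points := by
  obtain ⟨k, hk, hk1, hk2⟩ := exists_piece_index D.hN ht
  rw [D.homA_eval hk s ⟨hk1, hk2⟩]
  exact (D.pieceA_memΩ hk s t).2

/-- At `s = 0`, `K_A` is the reparametrised path `γ ∘ f`. [folklore] -/
theorem homA_zero_left {t : ℝ} (ht : t ∈ Icc (0 : ℝ) 1) : D.homA (0, t) = pext γ (D.repar t) := by
  obtain ⟨k, hk, hk1, hk2⟩ := exists_piece_index D.hN ht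
  rw [D.homA_eval hk 0 ⟨hk1, hk2⟩, pieceA_zero_left (D.hlam0 k hk.le) (D.hlam0' hk),
    D.repar_eval hk ⟨hk1, hk2⟩]

/-- `K_A(s, 0) = γ(0)`. [folklore] -/
theorem homA_left_zero (s : ℝ) : D.homA (s, 0) = γ.toFun 0 := by
  rw [D.homA_eval D.hN s zero_mem_firstPiece, pieceA_of_le D.hN (D.hlam0' D.hN) (by simp),
    D.hlam00]

/-- `K_A(s, 1) = γ(1)`. [folklore] -/
theorem homA_left_one (s : ℝ) : D.homA (s, 1) = γ.toFun 1 := by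
  have hk : D.N - 1 < D.N := Nat.sub_lt D.hN one_pos
  rw [D.homA_eval hk s (one_mem_lastPiece D.hN),
    pieceA_of_ge D.hN (D.hlam0 _ hk.le) (by rw [pred_add_one_div D.hN]),
    Nat.sub_add_cancel (Nat.one_le_of_lt D.hN), D.hlamNN]

/-! ### The chart-straight homotopy -/

/-- The end `K_A(1, ·)` of the link-insertion homotopy on the `r`-th piece: the path
`λ_r⁻¹ ⋆ γ|[r/N,(r+1)/N] ⋆ λ_{r+1}`. [folklore] -/
def pathA (r : ℕ) (t : ℝ) : Fin Z.n → ℂ := pieceA (pext γ) D.lam D.N r (1, t)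

/-- The `r`-th piece `σ_r(φ(N t − r))` of `γ'`. [folklore] -/
def pathB (r : ℕ) (t : ℝ) : Fin Z.n → ℂ := (D.sg r).toFun (flatStep ((D.N : ℝ) * t - r))

/-- **The chart-straight homotopy** `K_B(s,t) = b₀ + Σ_r (pieceB_r(s,t) − b_r)` from `K_A(1,·)` to
`γ'`: on the `k`-th piece it is the straight-line homotopy in the chart `ψ_k`. [folklore] -/
def homB (q : ℝ × ℝ) : Fin Z.n → ℂ :=
  D.b 0 + ∑ r ∈ Finset.range D.N, (pieceB (D.ψ r) (D.i r) (D.pathA r) (D.pathB r) q - D.b r)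

/-- `pathA_r` lies in `Ω_r ∩ Z(ℂ)`. [folklore] -/
theorem pathA_mem {r : ℕ} (hr : r < D.N) (t : ℝ) : D.pathA r t ∈ D.Ω r ∩ Z.points :=
  D.pieceA_memΩ hr 1 t

/-- `pathB_r` lies in `Ω_r ∩ Z(ℂ)`. [folklore] -/
theorem pathB_mem {r : ℕ} (hr : r < D.N) (t : ℝ) : D.pathB r t ∈ D.Ω r ∩ Z.points :=
  ⟨D.hsgΩ r hr _ (flatStep_mem _), (D.sg r).mem_points _ (flatStep_mem _)⟩

/-- `pathA_r` is continuous. [folklore] -/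
theorem continuous_pathA {r : ℕ} (hr : r < D.N) : Continuous (D.pathA r) :=
  (continuous_pieceA (continuous_pext γ) (D.hlamc r hr.le)
    (D.hlamc (r + 1) (Nat.succ_le_of_lt hr))).comp (continuous_const.prodMk continuous_id)

/-- `pathB_r` is continuous. [folklore] -/
theorem continuous_pathB (r : ℕ) : Continuous (D.pathB r) :=
  (D.sg r).contDiffOn.continuousOn.comp_continuous
    (continuous_flatStep.comp ((continuous_const.mul continuous_id).sub continuous_const))
    (fun _ => flatStep_mem _)

/-- Left of the piece `pathA_r = b_r`. [folklore] -/
theorem pathA_of_le {r : ℕ} (hr : r < D.N) {t : ℝ} (ht : t ≤ (r : ℝ) / D.N) :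
    D.pathA r t = D.b r := by
  unfold pathA
  rw [pieceA_of_le D.hN (D.hlam0' hr) ht, D.hlam1 r hr.le]

/-- Right of the piece `pathA_r = b_{r+1}`. [folklore] -/
theorem pathA_of_ge {r : ℕ} (hr : r < D.N) {t : ℝ} (ht : ((r : ℝ) + 1) / D.N ≤ t) :
    D.pathA r t = D.b (r + 1) := by
  unfold pathA
  rw [pieceA_of_ge D.hN (D.hlam0 r hr.le) ht, D.hlam1 (r + 1) (Nat.succ_le_of_lt hr)]

/-- Evaluation of `K_B` on the `k`-th piece. [folklore] -/
theorem homB_eval {k : ℕ} (hk : k < D.N) (s : ℝ) {t : ℝ}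
    (ht : t ∈ Icc ((k : ℝ) / D.N) (((k : ℝ) + 1) / D.N)) :
    D.homB (s, t) = pieceB (D.ψ k) (D.i k) (D.pathA k) (D.pathB k) (s, t) := by
  unfold homB
  refine telescope_eval D.b (fun r => pieceB (D.ψ r) (D.i r) (D.pathA r) (D.pathB r) (s, t)) hk
    (fun r hr => ?_) (fun r hkr hrN => ?_)
  · have hrN : r < D.N := hr.trans hk
    have ht' : ((r : ℝ) + 1) / D.N ≤ t := succ_div_le_of_lt hr ht.1
    have hA : D.pathA r t = D.b (r + 1) := D.pathA_of_ge hrN ht'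
    rw [pieceB_of_eq (hA.trans (D.sg_flatStep_of_ge hrN ht').symm)
      (by rw [hA]; exact (D.h1 r _ (D.hbΩ' hrN).1 (D.hbΩ' hrN).2).2), hA]
  · have ht' : t ≤ (r : ℝ) / D.N := le_div_of_lt hkr ht.2
    have hA : D.pathA r t = D.b r := D.pathA_of_le hrN ht'
    rw [pieceB_of_eq (hA.trans (D.sg_flatStep_of_le hrN ht').symm)
      (by rw [hA]; exact (D.h1 r _ (D.hbΩ hrN).1 (D.hbΩ hrN).2).2), hA]

/-- `K_B` is continuous on `ℝ²`. [folklore] -/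
theorem continuous_homB : Continuous D.homB := by
  unfold homB
  refine continuous_const.add (continuous_finsetSum _ fun r hr => Continuous.sub ?_ continuous_const)
  have hrN : r < D.N := Finset.mem_range.mp hr
  exact continuous_pieceB (D.hTc r) (D.hψc r) (D.continuous_pathA hrN) (D.continuous_pathB r)
    (fun t => (D.h1 r _ (D.pathA_mem hrN t).1 (D.pathA_mem hrN t).2).1)
    (fun t => (D.h1 r _ (D.pathB_mem hrN t).1 (D.pathB_mem hrN t).2).1)

/-- `K_B([0,1]²) ⊆ Z(ℂ)` (indeed for all `s`). [folklore] -/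
theorem homB_mem (s : ℝ) {t : ℝ} (ht : t ∈ Icc (0 : ℝ) 1) : D.homB (s, t) ∈ Z.points := by
  obtain ⟨k, hk, hk1, hk2⟩ := exists_piece_index D.hN ht
  rw [D.homB_eval hk s ⟨hk1, hk2⟩]
  exact (pieceB_mem (S := D.Ω k ∩ Z.points) (D.hTc k) (fun w hw => D.h2 k w hw)
    (fun t => (D.h1 k _ (D.pathA_mem hk t).1 (D.pathA_mem hk t).2).1)
    (fun t => (D.h1 k _ (D.pathB_mem hk t).1 (D.pathB_mem hk t).2).1) _).2

/-- At `s = 0`, `K_B` is `K_A(1, ·)`. [folklore] -/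
theorem homB_zero_left {t : ℝ} (ht : t ∈ Icc (0 : ℝ) 1) : D.homB (0, t) = D.homA (1, t) := by
  obtain ⟨k, hk, hk1, hk2⟩ := exists_piece_index D.hN ht
  rw [D.homB_eval hk 0 ⟨hk1, hk2⟩, D.homA_eval hk 1 ⟨hk1, hk2⟩,
    pieceB_zero_left (D.h1 k _ (D.pathA_mem hk t).1 (D.pathA_mem hk t).2).2]
  rfl

/-- At `s = 1`, `K_B` is `γ'`. [folklore] -/
theorem homB_one_left {t : ℝ} (ht : t ∈ Icc (0 : ℝ) 1) : D.homB (1, t) = D.newPath t := by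
  obtain ⟨k, hk, hk1, hk2⟩ := exists_piece_index D.hN ht
  rw [D.homB_eval hk 1 ⟨hk1, hk2⟩, D.newPath_eval hk ⟨hk1, hk2⟩,
    pieceB_one_left (D.h1 k _ (D.pathB_mem hk t).1 (D.pathB_mem hk t).2).2]
  rfl

/-- `K_B(s, 0) = γ(0)`. [folklore] -/
theorem homB_left_zero (s : ℝ) : D.homB (s, 0) = γ.toFun 0 := by
  have h0 : (0 : ℝ) ≤ ((0 : ℕ) : ℝ) / D.N := by simp
  have hA : D.pathA 0 0 = D.b 0 := D.pathA_of_le D.hN h0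
  rw [D.homB_eval D.hN s zero_mem_firstPiece,
    pieceB_of_eq (hA.trans (D.sg_flatStep_of_le D.hN h0).symm)
      (by rw [hA]; exact (D.h1 0 _ (D.hbΩ D.hN).1 (D.hbΩ D.hN).2).2), hA, D.hb0]

/-- `K_B(s, 1) = γ(1)`. [folklore] -/
theorem homB_left_one (s : ℝ) : D.homB (s, 1) = γ.toFun 1 := by
  have hk : D.N - 1 < D.N := Nat.sub_lt D.hN one_pos
  have h1 : (((D.N - 1 : ℕ) : ℝ) + 1) / D.N ≤ 1 := by rw [pred_add_one_div D.hN]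
  have hA : D.pathA (D.N - 1) 1 = D.b (D.N - 1 + 1) := D.pathA_of_ge hk h1
  rw [D.homB_eval hk s (one_mem_lastPiece D.hN),
    pieceB_of_eq (hA.trans (D.sg_flatStep_of_ge hk h1).symm)
      (by rw [hA]; exact (D.h1 _ _ (D.hbΩ' hk).1 (D.hbΩ' hk).2).2), hA,
    Nat.sub_add_cancel (Nat.one_le_of_lt D.hN), D.hbN]

/-! ### Paths and homotopies in the subspace `Z(ℂ)` -/

/-- `γ'` as a `C¹` path on `Z` with algebraic end points `γ(0)`, `γ(1)`. [folklore] -/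
def newCurvePath : CurvePath Z where
  toFun := D.newPath
  contDiffOn := D.contDiff_newPath.contDiffOn
  mem_points := fun _ ht => D.newPath_mem ht
  algebraic_zero := fun j => by rw [D.newPath_zero]; exact γ.algebraic_zero j
  algebraic_one := fun j => by rw [D.newPath_one]; exact γ.algebraic_one j

/-- The change of parameter `f` as a self-map of the unit interval. [folklore] -/
def reparI (t : I) : I := ⟨D.repar t, D.repar_mem t.2⟩

/-- `f` is continuous. [folklore] -/
theorem continuous_reparI : Continuous D.reparI :=
  (D.continuous_repar.comp continuous_subtype_val).subtype_mk _

/-- `f(0) = 0`. [folklore] -/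
theorem reparI_zero : D.reparI 0 = 0 := Subtype.ext D.repar_zero

/-- `f(1) = 1`. [folklore] -/
theorem reparI_one : D.reparI 1 = 1 := Subtype.ext D.repar_one

/-- The intermediate path `K_A(1, ·)` (γ with the links inserted). [folklore] -/
def midPath : Path γ.src γ.tgt where
  toFun := fun t => ⟨D.homA (1, t), D.homA_mem 1 t.2⟩
  continuous_toFun :=
    (D.continuous_homA.comp (continuous_const.prodMk continuous_subtype_val)).subtype_mk _
  source' := Subtype.ext (D.homA_left_zero 1)
  target' := Subtype.ext (D.homA_left_one 1)

/-- `γ'` as a path in the subspace `Z(ℂ)`. [folklore] -/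
def newPath' : Path γ.src γ.tgt where
  toFun := fun t => ⟨D.newPath t, D.newPath_mem t.2⟩
  continuous_toFun := (D.continuous_newPath.comp continuous_subtype_val).subtype_mk _
  source' := Subtype.ext D.newPath_zero
  target' := Subtype.ext D.newPath_one

/-- The reparametrised `γ`. [folklore] -/
def reparPath : Path γ.src γ.tgt :=
  γ.toPath.reparam D.reparI D.continuous_reparI D.reparI_zero D.reparI_one

/-- **The link-insertion homotopy** `γ ∘ f ≃ K_A(1, ·)` with fixed end points. [folklore] -/
def homotopyA : Path.Homotopy D.reparPath D.midPath where
  toFun := fun st => ⟨D.homA (st.1, st.2), D.homA_mem _ st.2.2⟩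
  continuous_toFun := (D.continuous_homA.comp ((continuous_subtype_val.comp continuous_fst).prodMk
    (continuous_subtype_val.comp continuous_snd))).subtype_mk _
  map_zero_left := fun t => Subtype.ext (by
    show D.homA (0, t) = γ.toFun (D.repar t)
    rw [D.homA_zero_left t.2, pext_of_mem γ (D.repar_mem t.2)])
  map_one_left := fun _ => rfl
  prop' := fun s t ht => by
    show (⟨D.homA (s, t), _⟩ : Z.points) = D.reparPath t
    rcases ht with ht | ht
    · rw [ht]
      exact Subtype.ext ((D.homA_left_zero s).trans (congrArg Subtype.val D.reparPath.source.symm))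
    · rw [Set.mem_singleton_iff] at ht
      rw [ht]
      exact Subtype.ext ((D.homA_left_one s).trans (congrArg Subtype.val D.reparPath.target.symm))

/-- **The chart-straight homotopy** `K_A(1, ·) ≃ γ'` with fixed end points. [folklore] -/
def homotopyB : Path.Homotopy D.midPath D.newPath' where
  toFun := fun st => ⟨D.homB (st.1, st.2), D.homB_mem _ st.2.2⟩
  continuous_toFun := (D.continuous_homB.comp ((continuous_subtype_val.comp continuous_fst).prodMk
    (continuous_subtype_val.comp continuous_snd))).subtype_mk _
  map_zero_left := fun t => Subtype.ext (by
    show D.homB (0, t) = D.homA (1, t)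
    exact D.homB_zero_left t.2)
  map_one_left := fun t => Subtype.ext (by
    show D.homB (1, t) = D.newPath t
    exact D.homB_one_left t.2)
  prop' := fun s t ht => by
    show (⟨D.homB (s, t), _⟩ : Z.points) = D.midPath t
    rcases ht with ht | ht
    · rw [ht]
      exact Subtype.ext ((D.homB_left_zero s).trans (congrArg Subtype.val D.midPath.source.symm))
    · rw [Set.mem_singleton_iff] at ht
      rw [ht]
      exact Subtype.ext ((D.homB_left_one s).trans (congrArg Subtype.val D.midPath.target.symm))

/-- **Assembly**: from the data, a semialgebraic `C¹` path `γ'` on `Z` homotopic to `γ` with fixed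
end points (`γ ≃ γ ∘ f` by `Path.Homotopy.reparam`, then `homotopyA`, then `homotopyB`).
[cite: HuberWustholz2022, §3.3.1] -/
theorem assemble (D : SaData Z γ) : ∃ γ' : CurvePath Z,
    IsSemialgebraicMapOn ℚ {z : Fin 1 → ℝ | z 0 ∈ Set.Icc (0 : ℝ) 1}
      (fun z => Fin.append (fun i => (γ'.toFun (z 0) i).re) (fun i => (γ'.toFun (z 0) i).im)) ∧
    ∃ (x y : Z.points) (p p' : Path x y), (∀ t : I, γ.toFun t = p t) ∧ (∀ t : I, γ'.toFun t = p' t) ∧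
      p.Homotopic p' :=
  ⟨D.newCurvePath, D.isSemialgebraicMapOn_newPath, γ.src, γ.tgt, γ.toPath, D.newPath', fun _ => rfl,
    fun _ => rfl,
    Path.Homotopic.trans (Path.Homotopic.trans
      ⟨Path.Homotopy.reparam γ.toPath D.reparI D.continuous_reparI D.reparI_zero D.reparI_one⟩
      ⟨D.homotopyA⟩) ⟨D.homotopyB⟩⟩

end SaData

end Summit.KontsevichZagierPeriods.SymplecticScissors.RealOnePeriodRelations.SaHomotopic

namespace Summit.KontsevichZagierPeriods.SymplecticScissors.RealOnePeriodRelations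

/-- HELPER STUB `helper_saHomotopic_3` (registered on stmt-KontsevichZagierPeriods-10042): assembly of
the semialgebraic representative and of the homotopy from the data (= `SaHomotopic.SaData.assemble`).
[cite: HuberWustholz2022, §3.3.1] -/
theorem helper_saHomotopic_3 :
    ∀ {Z : CurveData} {γ : CurvePath Z},
    Summit.KontsevichZagierPeriods.SymplecticScissors.RealOnePeriodRelations.SaHomotopic.SaData Z γ
    → ∃ γ' : CurvePath Z, IsSemialgebraicMapOn ℚ {z : Fin 1 → ℝ | z 0 ∈ Set.Icc (0 : ℝ) 1} (fun z
    => Fin.append (fun i => (γ'.toFun (z 0) i).re) (fun i => (γ'.toFun (z 0) i).im)) ∧ ∃ (x y :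
    Z.points) (p p' : Path x y), (∀ t : I, γ.toFun t = p t) ∧ (∀ t : I, γ'.toFun t = p' t) ∧
    p.Homotopic p' :=
  fun D => D.assemble

end Summit.KontsevichZagierPeriods.SymplecticScissors.RealOnePeriodRelations

end
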